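import Summits.CriticalPhenomena.CardyFormulaZ2.Theorems.CardyIKTransportIKMixedBoxCrossingDefectStubRowGlue
import Summits.CriticalPhenomena.CardyFormulaZ2.Theorems.CardyIKTransportIKMixedBoxCrossingDefectStubRowFactorisation
import Summits.CriticalPhenomena.CardyFormulaZ2.Theorems.CardyIKTransportIKMixedBoxCrossingStubFiniteEnergy

/-!
# Stub `stub_glueFirstPos` of the line `defect-closure-exploration` (crux `IKMixedBoxCrossing`,
# stmt-CriticalPhenomena-5911)

POSITIVITY OF THE FIRST ROW-GLUE MOMENT: `0 < glueFirst S a n n` for every column pattern `S`, every scale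
`n ≥ 1` and every position `a` of the tall box `[a, a+n) × [-n, n]` cut by the cell row `0`.

PROOF (finite energy, no literature fact).
* By the landed `RowFactorisation` (`stub_rowFactorisation`) and `RowGlueStub.glueFirst_eq`,
  `glueFirst S a n n = Σ_i ν(E_i)` with the glue events `E_i = upArm_i ∩ loArm_i ∩ {(a+i, 0) black}`; every
  term is nonnegative, so it suffices that one (in fact each) `E_i` has positive mass.
* ALL-BLACK COLUMN (`glue_of_column`): if the `2n+1` cells `(a+i, y)`, `-n ≤ y ≤ n`, are black then `E_i`
  holds — the vertical black runs `(a+i, 1) … (a+i, n)` inside the upper half-box and `(a+i, -1) … (a+i, -n)`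
  inside the lower half-box are open paths of the triangulation whatever the diagonals (`openConnIn_vseg`:
  vertical neighbours are always edges), reaching the top row of `U` and the bottom row of `L`.
* FINITE ENERGY (`crsw_condBound_of_cellFlips` with the sharp single-cell flips `exists_cellFlip_sharp` of the
  landed `stub_finiteEnergy` file): forcing the `2n+1` cells of the column black costs at most the factor
  `(2 · 16/9)^{2n+1}`, so `ν(E_i) ≥ (32/9)^{-(2n+1)} · ν(univ) = (32/9)^{-(2n+1)} > 0`.
-/

noncomputable section

namespace Summit.CriticalPhenomena.CardyFormulaZ2.Cruxes.IKMixedBoxCrossing.DefectClosureExploration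

open scoped BigOperators Classical
open MeasureTheory Finset
open Literature.Probability.Percolation Literature.Probability.LatticeModels
open Summit.CriticalPhenomena.CardyFormulaZ2.Theorems.IKLinearTransport.PinnedDiagramExchange
  (Obs νmix blackEdges determinedOn isProbabilityMeasure_nuMix crsw_condBound_of_cellFlips crsw_factor_props)
open Summit.CriticalPhenomena.CardyFormulaZ2.Theorems.IKLinearTransport.PinnedDiagramExchange.CouplingToLimits
  (mk_mem_blackEdges_iff)
open Summit.CriticalPhenomena.CardyFormulaZ2.Cruxes.IKMixedBoxCrossing.PairedMirrorExploration.FiniteEnergyStub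
  (exists_cellFlip_sharp)

namespace GlueFirstPosStub

/-! ## §1 Vertical black runs are open paths of every triangulation -/

/-- A vertical segment of black cells `(c, y), (c, y+1), …, (c, y')` inside `X` joins its ends inside `X` in
the black-edge configuration (vertical neighbours are edges of every triangulation). -/
theorem openConnIn_vseg (x : Obs) (X : Set (Site 2)) (c y y' : ℤ) (hyy' : y ≤ y')
    (hmem : ∀ z : ℤ, y ≤ z → z ≤ y' → (![c, z] : Site 2) ∈ X)
    (hbl : ∀ z : ℤ, y ≤ z → z ≤ y' → (![c, z] : Site 2) ∈ x.1) :
    blackEdges x ∈ openConnIn X ![c, y] ![c, y'] := by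
  obtain ⟨m, rfl⟩ : ∃ m : ℕ, y' = y + m := ⟨(y' - y).toNat, by omega⟩
  clear hyy'
  induction m with
  | zero =>
    simp only [Nat.cast_zero, add_zero] at hmem ⊢
    exact openConnIn_refl (hmem y le_rfl le_rfl)
  | succ m ih =>
    have h1 : blackEdges x ∈ openConnIn X ![c, y] ![c, y + (m : ℕ)] :=
      ih (fun z h1 h2 => hmem z h1 (by push_cast; omega)) (fun z h1 h2 => hbl z h1 (by push_cast; omega))
    have hu : (![c, y + (m : ℕ)] : Site 2) ∈ X := hmem _ (by omega) (by push_cast; omega)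
    have hv : (![c, y + ((m + 1 : ℕ) : ℤ)] : Site 2) ∈ X := hmem _ (by push_cast; omega) le_rfl
    have hub : (![c, y + (m : ℕ)] : Site 2) ∈ x.1 := hbl _ (by omega) (by push_cast; omega)
    have hvb : (![c, y + ((m + 1 : ℕ) : ℤ)] : Site 2) ∈ x.1 := hbl _ (by push_cast; omega) le_rfl
    have he : s(![c, y + (m : ℕ)], ![c, y + ((m + 1 : ℕ) : ℤ)]) ∈ blackEdges x :=
      (mk_mem_blackEdges_iff _ _ _).2
        (Or.inl ⟨hub, hvb, Or.inr (Or.inl (by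
          ext j; fin_cases j
          · simp
          · simp
            omega))⟩)
    have hne : (![c, y + (m : ℕ)] : Site 2) ≠ ![c, y + ((m + 1 : ℕ) : ℤ)] := fun e => by
      have := congrFun e 1
      simp only [Matrix.cons_val_one, Matrix.cons_val_fin_one] at this
      push_cast at this
      omega
    exact PlanarDuality.openConnIn_trans h1 (openConnIn_of_adj hu hv he hne)

/-! ## §2 An all-black column glues -/

/-- ALL-BLACK COLUMN: if the cells `(a+i, y)`, `-n ≤ y ≤ n`, are black then column `i` carries an upper arm,
a black axis cell and a lower arm. -/
theorem glue_of_column (a : ℤ) (n : ℕ) (hn : 1 ≤ n) (i : Fin n) (x : Obs)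
    (hcol : ∀ z : ℤ, -(n : ℤ) ≤ z → z ≤ n → (![a + i, z] : Site 2) ∈ x.1) :
    x ∈ upArm a n n i ∩ loArm a n n i ∩ {x | (![a + i, 0] : Site 2) ∈ x.1} := by
  have hik : (i : ℕ) < n := i.isLt
  refine ⟨⟨⟨hcol 1 (by omega) (by exact_mod_cast hn), ![a + i, 1], rfl, ![a + i, (n : ℤ)], ?_, ?_⟩,
    hcol (-1) (by omega) (by omega), ![a + i, -1], rfl, ![a + i, -(n : ℤ)], ?_, ?_⟩,
    hcol 0 (by omega) (by omega)⟩
  · simp only [upTop, Set.mem_setOf_eq, Matrix.cons_val_zero, Matrix.cons_val_one, Matrix.cons_val_fin_one,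
      true_and]
    omega
  · exact openConnIn_vseg x (upBox a n n) (a + i) 1 n (by exact_mod_cast hn)
      (fun z h1 h2 => by
        simp only [upBox, Set.mem_setOf_eq, Matrix.cons_val_zero, Matrix.cons_val_one, Matrix.cons_val_fin_one]
        omega)
      (fun z h1 h2 => hcol z (by omega) h2)
  · simp only [loBot, Set.mem_setOf_eq, Matrix.cons_val_zero, Matrix.cons_val_one, Matrix.cons_val_fin_one,
      true_and]
    omega
  · rw [openConnIn_comm]
    exact openConnIn_vseg x (loBox a n n) (a + i) (-(n : ℤ)) (-1) (by omega)
      (fun z h1 h2 => by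
        simp only [loBox, Set.mem_setOf_eq, Matrix.cons_val_zero, Matrix.cons_val_one, Matrix.cons_val_fin_one]
        omega)
      (fun z h1 h2 => hcol z h1 (by omega))

/-! ## §3 Finite energy: the glue event of a column has positive mass -/

/-- POSITIVE MASS OF A GLUE COLUMN: `0 < ν(upArm_i ∩ loArm_i ∩ {(a+i, 0) black})`, by finite energy applied
to the all-black cylinder of the `2n+1` cells `(a+i, y)`, `-n ≤ y ≤ n` (which implies the glue event,
`glue_of_column`): forcing them black costs at most the finite factor `(2 · 16/9)^{2n+1}`. -/
theorem glue_real_pos (S : Set ℤ) (a : ℤ) (n : ℕ) (hn : 1 ≤ n) (i : Fin n) :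
    0 < (νmix S).real (upArm a n n i ∩ loArm a n n i ∩ {x | (![a + i, 0] : Site 2) ∈ x.1}) := by
  haveI := isProbabilityMeasure_nuMix S
  -- the column cells, as a finite set of cells off `Λ = ∅`
  set B : Finset (Site 2) := (Finset.Icc (-(n : ℤ)) n).image fun z : ℤ => (![a + i, z] : Site 2)
  have hdet : (Set.univ : Set Obs) ∈ determinedOn (∅ : Set (Site 2)) :=
    fun _ _ _ => ⟨fun _ => Set.mem_univ _, fun _ => Set.mem_univ _⟩
  have hBC : ∀ x : Obs, (∀ c ∈ B, c ∈ x.1) →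
      x ∈ upArm a n n i ∩ loArm a n n i ∩ {x | (![a + i, 0] : Site 2) ∈ x.1} :=
    fun x hx => glue_of_column a n hn i x fun z h1 h2 =>
      hx _ (Finset.mem_image_of_mem _ (Finset.mem_Icc.2 ⟨h1, h2⟩))
  have key := crsw_condBound_of_cellFlips exists_cellFlip_sharp ENNReal.ofReal_ne_top S MeasurableSet.univ hdet
    B (fun c _ => Set.notMem_empty c) hBC le_rfl
  obtain ⟨-, -, hMpos⟩ := crsw_factor_props exists_cellFlip_sharp ENNReal.ofReal_ne_top B.card
  rw [probReal_univ, mul_one, Set.univ_inter] at key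
  exact (inv_pos.2 hMpos).trans_le key

end GlueFirstPosStub

/-- **Registered stub `stub_glueFirstPos`** (line `defect-closure-exploration`, reshape v3c-a): the first row-glue
moment of the `n × (2n+1)` box is positive for every pattern, scale `n ≥ 1` and position — by `RowFactorisation`
it is the sum of the masses of the glue events `upArm_i ∩ loArm_i ∩ {(a+i,0) black}`, each of which contains the
all-black column cylinder of column `i`, of positive mass by finite energy. -/
theorem stub_glueFirstPos : ∀ (S : Set ℤ) (n : ℕ) (a : ℤ), 1 ≤ n → 0 < glueFirst S a n n := by
  intro S n a hn
  rw [RowGlueStub.glueFirst_eq stub_rowFactorisation]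
  exact sum_pos (fun i _ => GlueFirstPosStub.glue_real_pos S a n hn i) ⟨⟨0, hn⟩, mem_univ _⟩

end Summit.CriticalPhenomena.CardyFormulaZ2.Cruxes.IKMixedBoxCrossing.DefectClosureExploration

end
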